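import Literature.Computability.Complexity.BrickAlgebra
import Literature.Computability.Complexity.StackBricksStrings
import Literature.Computability.MetaComplexity.DistProblems
import HarnessLib

/-!
# Scheme-encoded algorithms as total `FP` string functions (bricks for heuristic schemes)

Topic `Literature/Computability/MetaComplexity`, toolkit for `DistProblems.lean` /
`UniversalHeuristicSchemes.lean`. Heuristic schemes, checkers and solvers of the average-case and
meta-complexity files are algorithms `A(x; 1ᵗ, 1ᵐ)` specified as
`PolyTimeComputable schemeEnc eb (fun q => A q.1 q.2.1 q.2.2)` on the **scheme encoding**
`schemeEnc (x, t, m) = ⟨x, ⟨1ᵗ, 1ᵐ⟩⟩` — i.e. only on *well-formed* input words. A machine that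
*calls* such an algorithm inside a larger polynomial-time computation written in the tree's
algebra of total `FP` string functions (`comp_mem_FP`, `fanoutFn`, `iteFn`, `Brick.loopFn_mem_FP`;
`BrickAlgebra.lean`) needs it as a **total** function `List Bool → List Bool` in `FP`. This file
provides the packaging (no machine is built; everything is composition of existing bricks):

* `decScheme w = (x, t, m)` — the total decoder (first pair component; the *lengths* of the two
  components of the second), a left inverse of `schemeEnc` (`decScheme_schemeEnc`);
* `normScheme = schemeEnc ∘ decScheme` written as a brick term (`normScheme_apply`), hence in `FP`
  (`normScheme_mem_FP`), i.e. `PolyTimeComputable id schemeEnc decScheme`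
  (`polyTimeComputable_decScheme`): every word is sent to a well-formed word, well-formed words
  are fixed;
* `schemeFn A w = [A x t m]` for `(x, t, m) = decScheme w` — the total one-bit string function of
  a curried Boolean algorithm; **`schemeFn_mem_FP`**: it is in `FP` whenever `A` is polynomial-time
  on `schemeEnc` (`PolyTimeComputable.comp_holds` with the normaliser); `schemeFn_schemeEnc` (on
  well-formed words it is the algorithm) and `oneBit_schemeFn` (the format of conditions of
  `iteFn`, `Brick.OneBit`).

First consumer: the `2^{O(n / log n)}`-time machine of Hirahara's Cor. 6.4
(`Hirahara2021_mem_DTIME_of_hasUHS`), whose polynomial-time stage calls the checker and the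
solver of a universal heuristic scheme inside a counted loop.

## References

* S. Arora, B. Barak, *Computational Complexity: A Modern Approach*, CUP 2009, §1.3 (polynomial
  time is closed under composition; representation changes), §0.1 (pairing).
* A. Bogdanov, L. Trevisan, *Average-Case Complexity*, Found. Trends TCS 2 (2006), Def. 2.4 (the
  parameters `(x; n, δ)` of a heuristic scheme, in unary).
-/

namespace Literature.Computability.MetaComplexity

open _root_.Computability Complexity

/-! ### The total decoder of the scheme encoding -/

/-- The total decoder of `schemeEnc`: `decScheme w = (x, t, m)` where `x` is the first pair
component of `w` and `t`, `m` are the **lengths** of the two pair components of the second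
(so arbitrary words decode; on `⟨x, ⟨1ᵗ, 1ᵐ⟩⟩` this is `(x, t, m)`). [Bogdanov–Trevisan 2006,
Def. 2.4 (parameters in unary); Arora–Barak 2009, §0.1] [folklore] -/
def decScheme (w : List Bool) : List Bool × ℕ × ℕ :=
  ((boolUnpair w).1, (boolUnpair (boolUnpair w).2).1.length, (boolUnpair (boolUnpair w).2).2.length)

/-- Mathlib's unary numeral is a block of `1`s (private copy of
`Complexity.unaryEncodeNat_eq_replicate` of `CookReducibilityTransitive.lean`, whose import
closure is not wanted here). [folklore] -/
private theorem unaryEncodeNat_eq_replicate' (n : ℕ) : unaryEncodeNat n = List.replicate n true := by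
  induction n with
  | zero => rfl
  | succ n ih => rw [List.replicate_succ, ← ih]; rfl

/-- `decScheme` is a left inverse of `schemeEnc`. [folklore] -/
@[simp] theorem decScheme_schemeEnc (q : List Bool × ℕ × ℕ) : decScheme (schemeEnc q) = q := by
  obtain ⟨x, t, m⟩ := q
  simp [decScheme, schemeEnc, unaryEncodeNat_eq_replicate']

/-! ### The normaliser -/

/-- The normaliser `w ↦ schemeEnc (decScheme w)` as a brick term: fan-out of the first
projection with the fan-out of the unary recodings (`Brick.onesMulFn 1`, i.e. `u ↦ 1^{|u|}`) of the two
components of the second projection. [Arora–Barak 2009, §1.3] [folklore] -/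
noncomputable def normScheme : List Bool → List Bool :=
  fanoutFn Brick.fstF
    (fanoutFn (Brick.onesMulFn 1 ∘ Brick.fstF ∘ Brick.sndF)
      (Brick.onesMulFn 1 ∘ Brick.sndF ∘ Brick.sndF))

/-- The normaliser computes `schemeEnc ∘ decScheme`. [folklore] -/
theorem normScheme_apply (w : List Bool) : normScheme w = schemeEnc (decScheme w) := by
  simp [normScheme, schemeEnc, decScheme, Brick.fstF, Brick.sndF, Brick.onesMulFn,
    unaryEncodeNat_eq_replicate']

/-- The normaliser is in `FP` (bricks: `fanoutFn_mem_FP`, `Brick.fstF_mem_FP`, `Brick.sndF_mem_FP`,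
`Brick.onesMulFn_mem_FP`, `comp_mem_FP`). [Arora–Barak 2009, §1.3] [folklore] -/
theorem normScheme_mem_FP : normScheme ∈ FP :=
  fanoutFn_mem_FP Brick.fstF_mem_FP
    (fanoutFn_mem_FP
      (comp_mem_FP (Brick.onesMulFn_mem_FP 1) (comp_mem_FP Brick.fstF_mem_FP Brick.sndF_mem_FP))
      (comp_mem_FP (Brick.onesMulFn_mem_FP 1) (comp_mem_FP Brick.sndF_mem_FP Brick.sndF_mem_FP)))

/-- **The decoder is polynomial-time into the scheme encoding**: some machine maps every word
`w` to the well-formed word `schemeEnc (decScheme w)` in polynomial time. This is the middle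
encoder through which scheme-specified algorithms compose with total `FP` functions
(`PolyTimeComputable.comp_holds`). [Arora–Barak 2009, §1.3] [folklore] -/
theorem polyTimeComputable_decScheme :
    PolyTimeComputable (id : List Bool → List Bool) schemeEnc decScheme := by
  obtain ⟨p, M, hM⟩ := normScheme_mem_FP
  refine ⟨p, M, fun w => ?_⟩
  have h := hM w
  rw [show (id (normScheme w) : List Bool) = schemeEnc (decScheme w) from normScheme_apply w] at h
  exact h

/-! ### Curried Boolean algorithms as total one-bit functions -/

/-- The total string function of a curried Boolean algorithm `A(x; 1ᵗ, 1ᵐ)`: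
`schemeFn A w = [A x t m]` for `(x, t, m) = decScheme w`. [folklore] -/
def schemeFn (A : List Bool → ℕ → ℕ → Bool) (w : List Bool) : List Bool :=
  encodeBool (A (decScheme w).1 (decScheme w).2.1 (decScheme w).2.2)

/-- On well-formed words `schemeFn A` is the algorithm: `schemeFn A ⟨x, ⟨1ᵗ, 1ᵐ⟩⟩ = [A x t m]`.
[folklore] -/
@[simp] theorem schemeFn_schemeEnc (A : List Bool → ℕ → ℕ → Bool) (x : List Bool) (t m : ℕ) :
    schemeFn A (schemeEnc (x, t, m)) = [A x t m] := by
  simp [schemeFn, encodeBool]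

/-- `schemeFn A` is one-bit on every input (the format of conditions of `iteFn`). [folklore] -/
theorem oneBit_schemeFn (A : List Bool → ℕ → ℕ → Bool) : Brick.OneBit (schemeFn A) :=
  fun _ => ⟨_, rfl⟩

/-- `|schemeFn A w| = 1`. [folklore] -/
@[simp] theorem length_schemeFn (A : List Bool → ℕ → ℕ → Bool) (w : List Bool) :
    (schemeFn A w).length = 1 := rfl

/-- **A scheme-specified polynomial-time algorithm is a total `FP` function.** If
`(x, t, m) ↦ A x t m` is polynomial-time on the scheme encoding (the hypothesis format of
`AvgP`/`HeurP` schemes and of `IsUniversalHeuristicScheme.solver_polyTime` /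
`checker_polyTime`), then `schemeFn A ∈ FP`: decode-and-normalise (`polyTimeComputable_decScheme`),
then run `A` (`PolyTimeComputable.comp_holds`). [Arora–Barak 2009, §1.3 (composition)]
[folklore] -/
theorem schemeFn_mem_FP {A : List Bool → ℕ → ℕ → Bool}
    (hA : PolyTimeComputable schemeEnc encodeBool fun q : List Bool × ℕ × ℕ => A q.1 q.2.1 q.2.2) :
    schemeFn A ∈ FP := by
  obtain ⟨p, M, hM⟩ := PolyTimeComputable.comp_holds hA polyTimeComputable_decScheme
  exact ⟨p, M, fun w => hM w⟩

end Literature.Computability.MetaComplexity
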